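import Literature.NumberTheory.EllipticCurves.DivisionFieldReducibleBorelKernel
import Literature.NumberTheory.EllipticCurves.WeilPairingProofs
import Mathlib.NumberTheory.Cyclotomic.Basic
import Mathlib.FieldTheory.Galois.Infinite
import Literature.NumberTheory.GaloisRepresentations.AbsGaloisGroup
import HarnessLib

/-!
# The Borel field of a line fixed by `Γ_{K(μ_p)}` lies in `K(μ_p)` — `det ρ̄_{E,p} = ω` through the Weil pairing
# (theorems only; no definition, no named fact)

Topic `NumberTheory/EllipticCurves` (namespace `WeierstrassCurve`, dot-notation on the curve, as in the sibling
`DivisionFieldReducibleBorelKernel.lean`).  Written by the prover seat `bsd-potss-rkm` g35 (cell `bsd-potss`, item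
stmt-BirchSwinnertonDyer-19196 `ReducibleKatoMember`, crux M of the routes K9 / K8-t′; `--supports`, closes nothing).

WHY.  For a line `C ≤ E[p]` of a reducible `E[p]` the Borel field `K(χ₁, χ₂) = W.borelField C` is the field cut out by
the character `χ₁` of `C` and the character `χ₂` of `E[p]/C`.  Since `χ₁ χ₂ = det ρ̄_{E,p} = ω` (the mod-`p` cyclotomic
character — Silverman, *AEC* III.8 / Cornell–Silverman–Stevens Ch. II §7–§8: «`det(ρ̄_m)` is the cyclotomic character»,
proved from the Weil pairing), `χ₂` is determined by `χ₁`: **if every `σ` fixing `K(μ_p)` fixes `C` pointwise, then it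
also acts trivially on `E[p]/C`, so `K(χ₁, χ₂) ⊆ K(μ_p)`.**  In particular a line of `K`-RATIONAL `p`-torsion points
(`χ₁ = 1`) and a `μ_p`-line (`χ₁ = ω`) both have Borel field inside `K(μ_p)`.  This is the bridge the cell's FW-free
statement (A) on the «cyclotomic-Borel rows» (`Theorems/KatoDescentPotSupersingularReducibleFineSelmerBorelCyclotomic`,
hypothesis `W.borelField C ≤ L` for a `p`-th cyclotomic `L ⊆ K̄`) needs to become class-wide on the `p`-torsion family.

PROOF (no determinant is formed; the Weil pairing `e_p` of the tree — `WeierstrassCurve.exists_weilPairing_holds`,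
*AEC* Prop. III.8.1, PROVED — does the work directly).  Let `g` generate `C` (cyclic of prime order) and let `σ` fix the
`p`-th cyclotomic field `L ⊆ K̄` pointwise, with `σ g = g`.  The values of `e_p` are `p`-th roots of unity, hence powers
of the primitive root `ζ ∈ L`, hence FIXED by `σ`; so for every `y ∈ E[p]`,
`e_p(g, σy) = e_p(σg, σy) = σ e_p(g, y) = e_p(g, y)`, i.e. `e_p(g, σy − y) = 1`.  The annihilator
`A = {z : e_p(g, z) = 1}` is a subgroup of `E[p]` containing `C = ℤg` (alternating) and different from `E[p]`
(non-degeneracy + skew-symmetry), so `#A = p` and `A = C`: `σy − y ∈ C`.  Thus `Gal(K̄/L) ≤ borelKernel C`, and the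
Galois correspondence for `K̄/K` (`InfiniteGalois.fixedField_fixingSubgroup`) gives `borelField C ≤ L`.

Results: `WeierstrassCurve.weilPairing_mem_of_isCyclotomicExtension` (values of `e_p` lie in any `p`-th cyclotomic
`L ⊆ K̄`), `WeierstrassCurve.mem_borelKernel_of_mem_fixingSubgroup_of_forall_smul_eq` (the kernel inclusion),
`WeierstrassCurve.borelField_le_of_forall_mem_fixingSubgroup_smul_eq` (the headline),
`WeierstrassCurve.borelField_le_of_forall_smul_eq` (a pointwise-`Γ_K`-fixed line: `K(χ₁,χ₂) ⊆ L` for EVERY `p`-th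
cyclotomic `L ⊆ K̄`), `WeierstrassCurve.exists_isCyclotomicExtension_intermediateField` (such an `L` exists: `K(ζ_p)`).

References: [SilvermanAEC2009] Prop. III.8.1 (Weil pairing), III.8.3 and Exercise 3.16 / V.2.3 (`det = cyclotomic`);
[SerreAbelianLadic1968] IV.1.1–1.2; [Serre1972] §4 (the Borel case: `ρ̄ = (χ₁ *; 0 χ₂)`, `χ₁χ₂ = χ`);
[Wuthrich2014] Lemma 14 (p. 396).  Design: no `instance`, no notation.  Axioms: `propext`, `Classical.choice`, `Quot.sound`.
-/

set_option autoImplicit false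

noncomputable section

open scoped Classical
open Field IntermediateField Literature.NumberTheory.EllipticCurves Literature.NumberTheory.GaloisRepresentations

universe u

namespace WeierstrassCurve

variable {K : Type u} [Field K] [CharZero K] (W : WeierstrassCurve K) {p : ℕ}

omit [CharZero K] in
/-- **`p`-th roots of unity of `K̄` lie in every `p`-th cyclotomic intermediate field `L ⊆ K̄`**: a primitive `p`-th
root `ζ ∈ L` exists (`IsCyclotomicExtension {p} K L`), and every `t ∈ K̄` with `t ^ p = 1` is a power of `ζ`
(`IsPrimitiveRoot.eq_pow_of_pow_eq_one`). [cite: Washington1997, Ch. 2 (basic properties of ℚ(ζ_n))] -/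
theorem _root_.IntermediateField.mem_of_pow_eq_one_of_isCyclotomicExtension [hp : Fact p.Prime]
    (L : IntermediateField K (AlgebraicClosure K)) [IsCyclotomicExtension {p} K L]
    {t : AlgebraicClosure K} (ht : t ^ p = 1) : t ∈ L := by
  haveI : NeZero p := ⟨hp.out.ne_zero⟩
  have hζ := IsCyclotomicExtension.zeta_spec p K L
  have hζ' : IsPrimitiveRoot ((IsCyclotomicExtension.zeta p K L : L) : AlgebraicClosure K) p :=
    hζ.map_of_injective (f := (algebraMap L (AlgebraicClosure K))) (algebraMap L (AlgebraicClosure K)).injective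
  obtain ⟨i, -, hi⟩ := hζ'.eq_pow_of_pow_eq_one ht
  rw [← hi]
  exact pow_mem (SetLike.coe_mem _) i

omit [CharZero K] in
/-- **The values of a Weil-type pairing on `E[p]` lie in every `p`-th cyclotomic `L ⊆ K̄`** (they are `p`-th roots of
unity). [cite: SilvermanAEC2009, Prop. III.8.1 (e_m takes values in μ_m)] -/
theorem weilPairing_mem_of_isCyclotomicExtension [Fact p.Prime]
    (L : IntermediateField K (AlgebraicClosure K)) [IsCyclotomicExtension {p} K L]
    {e : W.geomTorsion (p : ℤ) → W.geomTorsion (p : ℤ) → AlgebraicClosure K}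
    (hpow : ∀ S T, e S T ^ p = 1) (S T : W.geomTorsion (p : ℤ)) : e S T ∈ L :=
  IntermediateField.mem_of_pow_eq_one_of_isCyclotomicExtension L (hpow S T)

/-- **`Gal(K̄/L) ≤ borelKernel C` when `Gal(K̄/L)` fixes the line `C` pointwise** (membership form) (`E` elliptic over a field of
characteristic `0`, `p` prime, `C ≤ E[p]` with `C ≠ 0, E[p]`, `L ⊆ K̄` a `p`-th cyclotomic extension of `K`): every `σ`
fixing `L` and `C` pointwise satisfies `σy − y ∈ C` for all `y ∈ E[p]` — `χ₂ = ω χ₁⁻¹` through the Weil pairing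
(`e_p(g, σy − y) = 1` for a generator `g` of `C`; the annihilator of `g` is `C`).  [cite: SilvermanAEC2009, Prop. III.8.1 and III.8.3]
[cite: Serre1972, §4 (Borel image: χ₁χ₂ = det = χ)] -/
theorem mem_borelKernel_of_mem_fixingSubgroup_of_forall_smul_eq [W.IsElliptic] [hp : Fact p.Prime]
    (C : AddSubgroup (W.geomTorsion (p : ℤ))) (h1 : C ≠ ⊥) (h2 : C ≠ ⊤)
    (L : IntermediateField K (AlgebraicClosure K)) [IsCyclotomicExtension {p} K L]
    (hCL : ∀ σ : absoluteGaloisGroup K, σ ∈ (L.fixingSubgroup : Subgroup (absoluteGaloisGroup K)) →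
      ∀ x : W.geomTorsion (p : ℤ), x ∈ C → σ • x = x)
    (σ : absoluteGaloisGroup K) (hσ : σ ∈ (L.fixingSubgroup : Subgroup (absoluteGaloisGroup K))) :
    σ ∈ W.borelKernel C := by
  have hpr : p.Prime := hp.out
  haveI : NeZero p := ⟨hpr.ne_zero⟩
  -- cardinalities: `#E[p] = p²`, `#C = p`; a generator `g ≠ 0` of the cyclic group `C`
  have hV : Nat.card (W.geomTorsion (p : ℤ)) = p ^ 2 := W.natCard_geomTorsion_eq_sq_of_charZero hpr
  haveI : Finite (W.geomTorsion (p : ℤ)) :=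
    Nat.finite_of_card_ne_zero (by rw [hV]; exact pow_ne_zero 2 hpr.ne_zero)
  have hcard : Nat.card C = p := card_eq_of_ne_bot_of_ne_top hV h1 h2
  haveI : IsAddCyclic C := isAddCyclic_of_prime_card hcard
  obtain ⟨g, hg⟩ := IsAddCyclic.exists_generator (α := C)
  have hg0 : (g : W.geomTorsion (p : ℤ)) ≠ 0 := by
    intro h0
    have hg0' : g = 0 := Subtype.ext h0
    have hsub : ∀ x : C, x = 0 := fun x => by
      obtain ⟨k, hk⟩ := AddSubgroup.mem_zmultiples_iff.mp (hg x)
      rw [← hk, hg0', smul_zero]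
    haveI : Subsingleton C := ⟨fun a b => by rw [hsub a, hsub b]⟩
    have h1' : Nat.card C ≤ 1 := Finite.card_le_one_iff_subsingleton.mpr inferInstance
    rw [hcard] at h1'
    exact absurd h1' (not_le.mpr hpr.one_lt)
  -- the Weil pairing on `E[p]` (PROVED in the tree, AEC III.8.1)
  obtain ⟨e, hpow, haddl, haddr, hself, hnd, hgal⟩ :=
    W.exists_weilPairing_holds p hpr.two_le (Nat.cast_ne_zero.mpr hpr.ne_zero)
  have hne0 : ∀ S T, e S T ≠ 0 := fun S T h0 => by
    have := hpow S T
    rw [h0, zero_pow hpr.ne_zero] at this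
    exact zero_ne_one this
  have hzero : ∀ S, e S 0 = 1 := fun S => by
    have h := haddr S 0 0
    rw [add_zero] at h
    exact (mul_right_eq_self₀.mp h.symm).resolve_right (hne0 S 0)
  -- skew-symmetry from `e(T,T) = 1`
  have hskew : ∀ S T, e S T * e T S = 1 := fun S T => by
    have h := hself (S + T)
    rw [haddl, haddr, haddr, hself S, hself T, one_mul, mul_one] at h
    exact h
  -- the annihilator of `g`
  set g₀ : W.geomTorsion (p : ℤ) := (g : W.geomTorsion (p : ℤ)) with hg₀def
  let A : AddSubgroup (W.geomTorsion (p : ℤ)) :=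
    { carrier := {z | e g₀ z = 1}
      zero_mem' := hzero g₀
      add_mem' := fun {a b} ha hb => by
        change e g₀ (a + b) = 1
        rw [haddr, show e g₀ a = 1 from ha, show e g₀ b = 1 from hb, one_mul]
      neg_mem' := fun {a} ha => by
        change e g₀ (-a) = 1
        have h := haddr g₀ a (-a)
        rw [add_neg_cancel, hzero, show e g₀ a = 1 from ha, one_mul] at h
        exact h.symm }
  have hmemA : ∀ z, z ∈ A ↔ e g₀ z = 1 := fun z => Iff.rfl
  -- `C ≤ A` (`C = ℤ g`, `e(g, g) = 1`)
  have hgA : g₀ ∈ A := (hmemA g₀).mpr (hself g₀)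
  have hCA : C ≤ A := by
    intro x hx
    obtain ⟨k, hk⟩ := AddSubgroup.mem_zmultiples_iff.mp (hg ⟨x, hx⟩)
    have hx' : x = k • g₀ := by
      have := congrArg (fun z : C => (z : W.geomTorsion (p : ℤ))) hk
      simpa using this.symm
    rw [hx']
    exact A.zsmul_mem hgA k
  -- `A ≠ ⊤` (else `g` is in the left kernel, hence `g = 0`)
  have hAtop : A ≠ ⊤ := by
    intro htop
    apply hg0
    refine hnd g₀ fun S => ?_
    have h1' : e g₀ S = 1 := (hmemA S).mp (htop ▸ AddSubgroup.mem_top S)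
    have h := hskew g₀ S
    rwa [h1', one_mul] at h
  -- hence `A = C`
  have hAC : A = C := by
    have hdvd : Nat.card A ∣ p ^ 2 := hV ▸ AddSubgroup.card_addSubgroup_dvd_card A
    obtain ⟨i, hi, hAi⟩ := (Nat.dvd_prime_pow hpr).mp hdvd
    have hi2 : i ≠ 2 := by
      rintro rfl
      exact hAtop (AddSubgroup.eq_top_of_card_eq A (by rw [hAi, hV]))
    have hle : Nat.card A ≤ Nat.card C := by
      rw [hAi, hcard]
      interval_cases i
      · simpa using hpr.one_lt.le
      · simp
      · exact absurd rfl hi2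
    exact (AddSubgroup.eq_of_le_of_card_ge hCA hle).symm
  -- the inclusion
  have hfixL : ∀ t : AlgebraicClosure K, t ∈ L → σ • t = t := fun t ht =>
    (IntermediateField.mem_fixingSubgroup_iff L σ).mp hσ t ht
  have hσg : σ • g₀ = g₀ := hCL σ hσ g₀ g.2
  have key : ∀ y : W.geomTorsion (p : ℤ), σ • y - y ∈ C := fun y => by
    have hval : e g₀ y ∈ L := W.weilPairing_mem_of_isCyclotomicExtension L hpow g₀ y
    have h3 : e g₀ (σ • y) = e g₀ y := by
      rw [← hfixL _ hval, hgal σ g₀ y, hσg]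
    have h4 : e g₀ (σ • y - y) * e g₀ y = e g₀ y := by
      rw [← haddr, sub_add_cancel, h3]
    have h5 : e g₀ (σ • y - y) = 1 := (mul_left_eq_self₀.mp h4).resolve_right (hne0 g₀ y)
    rw [← hAC]
    exact (hmemA _).mpr h5
  exact ⟨hCL σ hσ, key⟩

/-- **`K(χ₁, χ₂) ⊆ L` when `Gal(K̄/L)` fixes `C` pointwise**, `L ⊆ K̄` any `p`-th cyclotomic extension of `K`
(`E` elliptic, `char K = 0`, `C ≤ E[p]` a line): the headline — `χ₁` trivial on `Gal(K̄/K(μ_p))` forces `χ₂ = ω χ₁⁻¹`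
trivial there too (Weil pairing), and the Galois correspondence for `K̄/K`. [cite: SilvermanAEC2009, Prop. III.8.1 and III.8.3]
[cite: Serre1972, §4 (Borel image: χ₁χ₂ = χ)] [cite: Wuthrich2014, Lemma 14 (p. 396)] -/
theorem borelField_le_of_forall_mem_fixingSubgroup_smul_eq [W.IsElliptic] [Fact p.Prime]
    (C : AddSubgroup (W.geomTorsion (p : ℤ))) (h1 : C ≠ ⊥) (h2 : C ≠ ⊤)
    (L : IntermediateField K (AlgebraicClosure K)) [IsCyclotomicExtension {p} K L]
    (hCL : ∀ σ : absoluteGaloisGroup K, σ ∈ (L.fixingSubgroup : Subgroup (absoluteGaloisGroup K)) →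
      ∀ x : W.geomTorsion (p : ℤ), x ∈ C → σ • x = x) :
    W.borelField C ≤ L := by
  rw [borelField_def, ← InfiniteGalois.fixedField_fixingSubgroup L]
  exact IntermediateField.fixedField_le fun σ hσ =>
    W.mem_borelKernel_of_mem_fixingSubgroup_of_forall_smul_eq C h1 h2 L hCL σ hσ

/-- **A line of `Γ_K`-FIXED `p`-torsion points has Borel field inside every `p`-th cyclotomic `L ⊆ K̄`** (`χ₁ = 1`,
`χ₂ = ω`): e.g. the line generated by a `K`-rational point of order `p`. [cite: Serre1972, §4 (Borel image; rational p-torsion: ρ̄ = (1 *; 0 χ))]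
[cite: SilvermanAEC2009, Prop. III.8.1 and III.8.3] -/
theorem borelField_le_of_forall_smul_eq [W.IsElliptic] [Fact p.Prime]
    (C : AddSubgroup (W.geomTorsion (p : ℤ))) (h1 : C ≠ ⊥) (h2 : C ≠ ⊤)
    (hfix : ∀ (σ : absoluteGaloisGroup K) (x : W.geomTorsion (p : ℤ)), x ∈ C → σ • x = x)
    (L : IntermediateField K (AlgebraicClosure K)) [IsCyclotomicExtension {p} K L] :
    W.borelField C ≤ L :=
  W.borelField_le_of_forall_mem_fixingSubgroup_smul_eq C h1 h2 L fun σ _ x hx => hfix σ x hx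

omit [CharZero K] in
/-- **`K(ζ_p) ⊆ K̄` is a `p`-th cyclotomic intermediate field** (`char K ∤ p`): a primitive `p`-th root of unity `ζ ∈ K̄`
exists and `K⟮ζ⟯` is `IsCyclotomicExtension {p} K`. [cite: Washington1997, Ch. 2 (ℚ(ζ_n))] -/
theorem exists_isCyclotomicExtension_intermediateField [hp : Fact p.Prime] [NeZero (p : K)] :
    ∃ L : IntermediateField K (AlgebraicClosure K), IsCyclotomicExtension {p} K L := by
  haveI : NeZero p := ⟨hp.out.ne_zero⟩
  haveI : NeZero ((p : ℕ) : AlgebraicClosure K) := NeZero.nat_of_injective (algebraMap K _).injective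
  obtain ⟨ζ, hζ⟩ := HasEnoughRootsOfUnity.prim (M := AlgebraicClosure K) (n := p)
  exact ⟨IntermediateField.adjoin K {ζ}, hζ.intermediateField_adjoin_isCyclotomicExtension K⟩

end WeierstrassCurve

end
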